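import Summits.BirchSwinnertonDyer.BirchSwinnertonDyer.Theorems.AlignedTransportAtTwoMainConjectureOfRankZeroBSDAtTwoSelmerLayerMuDoorCount
import Summits.BirchSwinnertonDyer.BirchSwinnertonDyer.Theorems.AlignedTransportAtTwoMainConjectureOfRankZeroBSDAtTwoSelmerLayerAllPrimes
import Summits.BirchSwinnertonDyer.BirchSwinnertonDyer.Theorems.AlignedTransportAtTwoMainConjectureOfRankZeroBSDAtTwoFineRoadTwoTorsionCoefficients
import Literature.NumberTheory.IwasawaTheory.IwasawaModuleLambdaLayersOfRankJump
import Literature.NumberTheory.EllipticCurves.IwasawaTowerTorsionProofs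
import Literature.NumberTheory.EllipticCurves.IwasawaSelmerControlKernelProofs
import HarnessLib

/-!
# Route `AlignedTransportAtTwo`, crux C2 `MainConjectureOfRankZeroBSDAtTwo` (stmt-BirchSwinnertonDyer-22298):
# THE SELMER RANK-JUMP `μ`-DOOR — `#Sel_k[p] · #ker g_k · p^{p^j} < #Sel_j[p] · p^{p^k}` at ONE pair of layers `j < k`
# forces `μ(X(E/K_∞)) = 0`, `X` torsion, and `p^{λ(X)} ≤ #Sel_k[p] · #ker g_k`; road (a) = stub T, PER CURVE, by `p`-descent

HONEST FRAMING (cell `bsd-f1-sign2`, WIDTH-5 attached prover seat `bsd-line-att-p5` gen 43 on line `birth` of the lead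
`bsd-line-att-p2`; `--supports` stmt-BirchSwinnertonDyer-22298, closes nothing; BSD is NOT proved by any of this; the crux
C2, its verdict «blocked-on `Rank1Residual.GreenbergMuConjectureIrreducible`» and every registered stub are untouched).
THEOREMS ONLY — no `def`, no instance, no named fact, no `sorry`. The registered OPEN stub T `SeedMuZeroAtTwo` asks, curve by
curve, for `D.IsTorsion → D.mu = 0` (`μ₂(X(W/ℚ_∞)) = 0`, Greenberg's Conj. 1.11 on the seed cell). The route text proposes
«`μ_alg = 0` per curve, decidable by `2`-descent over the first layer `ℚ(√2)`»; this file makes that honest: Fukuda's /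
Washington's small-RANK-JUMP mechanism (att-p3 g40 for class groups; this seat's `Literature/…/IwasawaModuleMuZeroOfRankJump`,
`…/IwasawaModuleLambdaLayersOfRankJump` for any finitely generated `Λ`-module) applied to the Selmer dual `X`, whose layer
quotients `X/(ω_n, p)X` are counted by `#Sel_∞^{Γ_n}[p]` (`…SelmerLayerMuDoorCount`) and squeezed between the honest layer Selmer
groups by g40–g42's control (`#Sel_n[p] ≤ #Sel_∞^{Γ_n}[p] ≤ #Sel_n[p] · #ker g_n` once `E(K_∞)[p^∞] = 0`). Because every good ordinary
curve is anomalous at `2` (`#ker g_n ≥ 4` at every layer), layer-one EQUALITY can never be certified at `2`; the door is the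
two-layer INEQUALITY, and it is COMPLETE (`μ = 0` ⟺ it opens at some pair, `IwasawaModuleRankJump.muInvariant_eq_zero_iff_exists_card_lt`).

* §3 (any abelian groups) `natCard_torsionBy_le_of_injective` — `f : A ↪ B` ⟹ `#B[p] ≤ #A[p] · #(B/f(A))`;
  (any number field `K`, any `ℤ_p`-extension, any `n`, `h_n` injective) `natCard_torsionBy_selmerLayer_le` (`#Sel_n[p] ≤ #Sel_∞^{Γ_n}[p]`),
  `natCard_torsionBy_selmerInvariants_le` (`#Sel_∞^{Γ_n}[p] ≤ #Sel_n[p] · #ker g_n`), `layerToInfty_injective_of_fixedPoints_eq_bot`.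
* §4 ★★★ `isTorsion_and_mu_eq_zero_of_selmer_rankJump` — **THE DOOR over any number field `K`**: `κ` any `ℤ_p`-extension with
  topological generator `γ`, `D` any dual datum with `X` finitely generated, `E(K_∞)[p^∞] = 0`, `ker g_k` finite, and
  `#Sel_k[p] · #ker g_k · p^{p^j} < #Sel_j[p] · p^{p^k}` for ONE pair `j < k` ⟹ `X` is `Λ`-torsion, `μ(X) = 0`, `X` is finitely
  generated over `ℤ_p`, `p^{λ(X)} ≤ #Sel_k[p] · #ker g_k`.
* §5 over `ℚ`: ★★★ `isTorsion_and_mu_eq_zero_of_selmer_rankJump_rat` (every good ordinary `p`, `E(ℚ)[p] = 0`, `κ` cyclotomic: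
  `ker g_n` finite by g42, `E(ℚ_∞)[p^∞] = 0` by the fixed-point principle — NO finite-generation / torsion / control hypothesis left);
  ★★★★ `seedMuZero_of_selmer_rankJump_two` — **stub T at `(W, κ, γ, D)` for EVERY `W/ℚ` good ordinary at `2` without rational
  `2`-torsion, from ONE inequality between `2`-descents at two layers `ℚ_j ⊂ ℚ_k` of the cyclotomic `ℤ₂`-tower**
  (`Sel_n = W.selmerLayer κ n ≃ Sel_{2^∞}(E_{ℚ_n}/ℚ_n)` by g39; `#ker g_n ≤ ∏_{v ∣ 2N} #𝒦_{v,n}`, at `v ∣ 2` equal to `#Ẽ(𝔽₂)(2)² ∈ {4,16}`).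

What this does NOT do: certify the inequality for any seed (that is a `2`-descent over `ℚ_2 = ℚ(ζ₁₆)⁺` / `ℚ_3` — a computation,
kit-sized, not attempted here); prove T (OPEN); touch the `μ`-conjecture. References: L. Washington, GTM 83, §13.3 Prop. 13.22–13.23
[Washington1997]; T. Fukuda, Proc. Japan Acad. 70 (1994) Thm. 1 [Fukuda1994]; R. Greenberg, LNM 1716 (1999), §1 pp. 60–62, Conj.
1.11, §3 Lemmas 3.1–3.4, §4 Lemma 4.3 [GreenbergLNM1716]; B. Mazur, Invent. Math. 18 (1972), §6 [Mazur1972].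
-/

set_option linter.dupNamespace false
set_option autoImplicit false

noncomputable section

open scoped Classical AddSubgroup

universe u

namespace Summit.BirchSwinnertonDyer.BirchSwinnertonDyer.Theorems.AlignedTransportAtTwoSelmerLayerMuDoor

open WeierstrassCurve Literature.NumberTheory.EllipticCurves Literature.NumberTheory.EllipticCurves.IwasawaDual
  Literature.NumberTheory.EllipticCurves.IwasawaAlgebra Literature.NumberTheory.IwasawaTheory.IwasawaModuleRankJump
  Summit.BirchSwinnertonDyer.BirchSwinnertonDyer.Theorems.AlignedTransportAtTwoSelmerLayerModel
  Summit.BirchSwinnertonDyer.BirchSwinnertonDyer.Theorems.AlignedTransportAtTwoSelmerLayerDuality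
  Summit.BirchSwinnertonDyer.BirchSwinnertonDyer.Theorems.AlignedTransportAtTwoSelmerLayerMuDoorCount

/-! ## §3 The control sandwich on `p`-torsion: `#Sel_n[p] ≤ #Sel_∞^{Γ_n}[p] ≤ #Sel_n[p] · #ker g_n` -/

section Sandwich

/-- **`f : A ↪ B` ⟹ `#B[p] ≤ #A[p] · #(B/f(A))`** (`A[p]`, `B/f(A)` finite): `B[p] → B/f(A)` has kernel `B[p] ∩ f(A) = f(A[p])`.
[folklore] -/
theorem natCard_torsionBy_le_of_injective {A B : Type*} [AddCommGroup A] [AddCommGroup B] (f : A →+ B)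
    (hf : Function.Injective f) (p : ℕ) [Finite (A[(p : ℤ)])] [Finite (B ⧸ f.range)] :
    Nat.card (B[(p : ℤ)]) ≤ Nat.card (A[(p : ℤ)]) * Nat.card (B ⧸ f.range) := by
  set π : B[(p : ℤ)] →+ B ⧸ f.range := (QuotientAddGroup.mk' f.range).comp (B[(p : ℤ)]).subtype with hπ
  have hπapp : ∀ x : B[(p : ℤ)], π x = QuotientAddGroup.mk (x : B) := fun _ ↦ rfl
  -- `#B[p] = #(B[p]/ker π) · #ker π`
  rw [AddSubgroup.card_eq_card_quotient_mul_card_addSubgroup π.ker, mul_comm]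
  refine Nat.mul_le_mul ?_ ?_
  · -- `ker π ≤ f(A[p])`: every element of the kernel is `f a` with `a ∈ A[p]`
    let g : A[(p : ℤ)] → π.ker := fun a ↦ ⟨⟨f a, by
        rw [AddSubgroup.torsionBy.nsmul_iff, ← map_nsmul, ← AddSubgroupClass.coe_nsmul, AddSubgroup.torsionBy.nsmul a,
          ZeroMemClass.coe_zero, map_zero]⟩, by
        rw [AddMonoidHom.mem_ker, hπapp, QuotientAddGroup.eq_zero_iff]
        exact ⟨a, rfl⟩⟩
    refine Nat.card_le_card_of_surjective g fun x ↦ ?_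
    have hx : ((x : B[(p : ℤ)]) : B) ∈ f.range := by
      rw [← QuotientAddGroup.eq_zero_iff, ← hπapp]
      exact x.2
    obtain ⟨a, ha⟩ := hx
    have hap : a ∈ A[(p : ℤ)] := by
      rw [AddSubgroup.torsionBy.nsmul_iff]
      apply hf
      rw [map_nsmul, ha, map_zero, ← AddSubgroupClass.coe_nsmul, AddSubgroup.torsionBy.nsmul, ZeroMemClass.coe_zero]
    exact ⟨⟨a, hap⟩, Subtype.ext (Subtype.ext ha)⟩
  · exact Nat.card_le_card_of_injective _ (QuotientAddGroup.kerLift_injective π)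

variable {K : Type u} [Field K] [NumberField K] (W : WeierstrassCurve K) {p : ℕ} [hp : Fact p.Prime]
  (κ : ZpExtension K p)

/-- `s_n : Sel_n → Sel_∞^{Γ_n}` is injective when `h_n` is (`s_n y = h_n y`). [cite: GreenbergLNM1716, §3 Lemma 3.1 (p. 86)] -/
theorem sMap_injective_of_injective (n : ℕ) (hinj : Function.Injective (W.layerToInfty κ n)) :
    Function.Injective (W.sMap κ n) := by
  intro y₁ y₂ h
  have h' := congrArg (fun s : ↥(W.selmerInfty κ ⊓ W.layerInvariants κ n) ↦ (s : W.subgroupH1 p κ.kerSubgroup)) h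
  simp only [coe_sMap_apply] at h'
  exact Subtype.ext (hinj h')

/-- **`#Sel_n[p] ≤ #Sel_∞^{Γ_n}[p]`** when `h_n` is injective (`Sel_∞^{Γ_n}[p]` finite). [cite: GreenbergLNM1716, §3 Lemma 3.1 (p. 86)] -/
theorem natCard_torsionBy_selmerLayer_le (n : ℕ) (hinj : Function.Injective (W.layerToInfty κ n))
    [Finite ((↥(W.selmerInfty κ ⊓ W.layerInvariants κ n))[(p : ℤ)])] :
    Finite ((↥(W.selmerLayer κ n))[(p : ℤ)]) ∧
      Nat.card ((↥(W.selmerLayer κ n))[(p : ℤ)]) ≤ Nat.card ((↥(W.selmerInfty κ ⊓ W.layerInvariants κ n))[(p : ℤ)]) := by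
  let t : (↥(W.selmerLayer κ n))[(p : ℤ)] → (↥(W.selmerInfty κ ⊓ W.layerInvariants κ n))[(p : ℤ)] := fun y ↦
    ⟨W.sMap κ n y, by
      rw [AddSubgroup.torsionBy.nsmul_iff, ← map_nsmul, ← AddSubgroupClass.coe_nsmul, AddSubgroup.torsionBy.nsmul y,
        ZeroMemClass.coe_zero, map_zero]⟩
  have ht : Function.Injective t := by
    intro y₁ y₂ h
    exact Subtype.ext (sMap_injective_of_injective W κ n hinj (congrArg Subtype.val h))
  exact ⟨Finite.of_injective t ht, Nat.card_le_card_of_injective t ht⟩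

/-- **`#Sel_∞^{Γ_n}[p] ≤ #Sel_n[p] · #ker g_n`** when `h_n` is injective and Greenberg's `ker g_n = A_n/Sel_n` is finite:
`0 → Sel_n → Sel_∞^{Γ_n} → coker s_n → 0` and `ker g_n ↠ coker s_n` (`coker h_n = 0`). [cite: GreenbergLNM1716, §3 p. 86 and §4 Lemma 4.3] -/
theorem natCard_torsionBy_selmerInvariants_le (n : ℕ) (hinj : Function.Injective (W.layerToInfty κ n))
    [Finite (W.KerG κ n)] [Finite ((↥(W.selmerInfty κ ⊓ W.layerInvariants κ n))[(p : ℤ)])] :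
    Nat.card ((↥(W.selmerInfty κ ⊓ W.layerInvariants κ n))[(p : ℤ)]) ≤
      Nat.card ((↥(W.selmerLayer κ n))[(p : ℤ)]) * Nat.card (W.KerG κ n) := by
  haveI := (natCard_torsionBy_selmerLayer_le W κ n hinj).1
  haveI hfinC : Finite (W.CokerS κ n) := Finite.of_surjective _ (W.kerGToCoker_surjective κ n)
  haveI : Finite (↥(W.selmerInfty κ ⊓ W.layerInvariants κ n) ⧸ (W.sMap κ n).range) := by
    rw [W.range_sMap_eq κ n]; exact hfinC
  have h1 := natCard_torsionBy_le_of_injective (W.sMap κ n) (sMap_injective_of_injective W κ n hinj) p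
  have h2 : Nat.card (↥(W.selmerInfty κ ⊓ W.layerInvariants κ n) ⧸ (W.sMap κ n).range) ≤ Nat.card (W.KerG κ n) := by
    rw [W.range_sMap_eq κ n]
    exact Nat.card_le_card_of_surjective _ (W.kerGToCoker_surjective κ n)
  exact h1.trans (Nat.mul_le_mul_left _ h2)

/-- **`h_n` is injective for every `n` once `E(K_∞)[p^∞] = 0`** (Greenberg's Lemma 3.1: `ker h_n ↪ B/(γ^{pⁿ} − 1)B`,
`B = E(K_∞)[p^∞]`). [cite: GreenbergLNM1716, §3 Lemma 3.1 (p. 86)] -/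
theorem layerToInfty_injective_of_fixedPoints_eq_bot {γ : Field.absoluteGaloisGroup K} (hγ : κ.IsTopGenerator γ)
    (hB : FixedPoints.addSubgroup κ.kerSubgroup (W.geomPrimaryTorsion p) = ⊥) (n : ℕ) :
    Function.Injective (W.layerToInfty κ n) := by
  -- adapted from Theorems/UniversalToricDescentLayerDegreeCertificate.lean §1 (same lemma, other route)
  haveI hsub : Subsingleton (FixedPoints.addSubgroup κ.kerSubgroup (W.geomPrimaryTorsion p)) := by
    rw [hB]; infer_instance
  haveI hfinQ : Finite (FixedPoints.addSubgroup κ.kerSubgroup (W.geomPrimaryTorsion p) ⧸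
      (ResKernel.subOne κ.kerSubgroup (W.geomPrimaryTorsion p) (γ ^ p ^ n)).range) :=
    Finite.of_surjective _ (QuotientAddGroup.mk'_surjective _)
  have hcardQ : Nat.card (FixedPoints.addSubgroup κ.kerSubgroup (W.geomPrimaryTorsion p) ⧸
      (ResKernel.subOne κ.kerSubgroup (W.geomPrimaryTorsion p) (γ ^ p ^ n)).range) ≤ 1 := by
    rw [Finite.card_le_one_iff_subsingleton]
    exact Quot.Subsingleton
  obtain ⟨hfin, hle⟩ := W.finite_ker_layerToInfty_and_card_le κ hγ n
  haveI := hfin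
  have hker : (W.layerToInfty κ n).ker = ⊥ := by
    rw [← AddSubgroup.card_le_one_iff_eq_bot]
    exact hle.trans hcardQ
  exact (AddMonoidHom.ker_eq_bot_iff _).mp hker

end Sandwich

/-! ## §4 THE DOOR over any number field -/

section Door

variable {K : Type u} [Field K] [NumberField K] (W : WeierstrassCurve K) {p : ℕ} [hp : Fact p.Prime]
  (κ : ZpExtension K p) {γ : Field.absoluteGaloisGroup K}

/-- ★★★ **THE SELMER RANK-JUMP `μ`-DOOR (any number field `K`, any `ℤ_p`-extension `κ` with topological generator `γ`, any
Pontryagin-dual datum `D` with `X = D.X` finitely generated over `Λ`).** If `E(K_∞)[p^∞] = 0`, Greenberg's `ker g_k` is finite,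
and for ONE pair of layers `j < k`
`#Sel_k[p] · #ker g_k · p^{p^j} < #Sel_j[p] · p^{p^k}` (`Sel_n = W.selmerLayer κ n`, the `p^∞`-Selmer group of the layer `K_n`
realised inside `H¹(K_n, E[p^∞])`), then `X` is `Λ`-torsion, **`μ(X) = 0`**, `X` is finitely generated over `ℤ_p`, and
`p^{λ(X)} ≤ #Sel_k[p] · #ker g_k`. Assembly: `#X/(ω_n,p)X = #Sel_∞^{Γ_n}[p]` (`…SelmerLayerMuDoorCount`), the sandwich of §3, and the
`Λ`-module criterion `IwasawaModuleRankJump.muInvariant_eq_zero_of_card_layerQuotient_lt`.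
[cite: Washington1997, §13.3 Prop. 13.22–13.23] [cite: Fukuda1994, Thm. 1] [cite: GreenbergLNM1716, §1 pp. 60–62, §3 Lemma 3.1, §4 Lemma 4.3] -/
theorem isTorsion_and_mu_eq_zero_of_selmer_rankJump (hγ : κ.IsTopGenerator γ) (D : W.SelmerDualData κ γ)
    [Module.Finite (IwasawaAlgebra p) D.X]
    (hB : FixedPoints.addSubgroup κ.kerSubgroup (W.geomPrimaryTorsion p) = ⊥)
    {j k : ℕ} (hjk : j < k) [Finite (W.KerG κ k)]
    (hlt : Nat.card ((↥(W.selmerLayer κ k))[(p : ℤ)]) * Nat.card (W.KerG κ k) * p ^ (p ^ j) <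
      Nat.card ((↥(W.selmerLayer κ j))[(p : ℤ)]) * p ^ (p ^ k)) :
    D.IsTorsion ∧ D.mu = 0 ∧ Module.Finite ℤ_[p] (RestrictScalars ℤ_[p] (IwasawaAlgebra p) D.X) ∧
      p ^ D.lambda ≤ Nat.card ((↥(W.selmerLayer κ k))[(p : ℤ)]) * Nat.card (W.KerG κ k) := by
  haveI := finite_torsionBy_selmerInvariants p W κ hγ D j
  haveI := finite_torsionBy_selmerInvariants p W κ hγ D k
  have hinjj := layerToInfty_injective_of_fixedPoints_eq_bot W κ hγ hB j
  have hinjk := layerToInfty_injective_of_fixedPoints_eq_bot W κ hγ hB k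
  have hQj := natCard_layerQuotientP_eq_natCard_torsionBy_selmerInvariants p W κ hγ D j
  have hQk := natCard_layerQuotientP_eq_natCard_torsionBy_selmerInvariants p W κ hγ D k
  have hlow := (natCard_torsionBy_selmerLayer_le W κ j hinjj).2
  have hup := natCard_torsionBy_selmerInvariants_le W κ k hinjk
  have hlt' : Nat.card (D.X ⧸ (Ideal.span {((1 + PowerSeries.X : PowerSeries ℤ_[p]) ^ (p ^ k) - 1 : IwasawaAlgebra p)} ⊔
        augIdealP p) • (⊤ : Submodule (IwasawaAlgebra p) D.X)) * p ^ (p ^ j) <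
      Nat.card (D.X ⧸ (Ideal.span {((1 + PowerSeries.X : PowerSeries ℤ_[p]) ^ (p ^ j) - 1 : IwasawaAlgebra p)} ⊔
        augIdealP p) • (⊤ : Submodule (IwasawaAlgebra p) D.X)) * p ^ (p ^ k) := by
    rw [hQj, hQk]
    calc Nat.card ((↥(W.selmerInfty κ ⊓ W.layerInvariants κ k))[(p : ℤ)]) * p ^ (p ^ j)
        ≤ Nat.card ((↥(W.selmerLayer κ k))[(p : ℤ)]) * Nat.card (W.KerG κ k) * p ^ (p ^ j) := Nat.mul_le_mul_right _ hup
      _ < Nat.card ((↥(W.selmerLayer κ j))[(p : ℤ)]) * p ^ (p ^ k) := hlt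
      _ ≤ Nat.card ((↥(W.selmerInfty κ ⊓ W.layerInvariants κ j))[(p : ℤ)]) * p ^ (p ^ k) := Nat.mul_le_mul_right _ hlow
  refine ⟨isTorsion_of_card_layerQuotient_lt hjk hlt', muInvariant_eq_zero_of_card_layerQuotient_lt hjk hlt',
    moduleFinite_padicInt_of_card_layerQuotient_lt hjk hlt', ?_⟩
  have hlam := pow_lambdaInvariant_le_of_card_layerQuotient_lt hjk hlt'
  rw [hQk] at hlam
  exact hlam.trans hup

end Door

/-! ## §5 Over `ℚ`: every good ordinary `p` (κ cyclotomic), and the cell's `p = 2` (stub T per curve) -/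

section Rat

open Literature.NumberTheory.EllipticCurves.Greenberg1999
  Summit.BirchSwinnertonDyer.BirchSwinnertonDyer.Theorems.AlignedTransportAtTwoSelmerLayerAllPrimes
  Summit.BirchSwinnertonDyer.BirchSwinnertonDyer.Theorems.AlignedTransportAtTwoFineRoad

variable (W : WeierstrassCurve ℚ) [W.IsElliptic] [W.IsGloballyMinimal] {p : ℕ} [hp : Fact p.Prime]
  (κ : ZpExtension ℚ p) {γ : Field.absoluteGaloisGroup ℚ}

/-- ★★★ **The door over `ℚ` at a good ordinary `p` with `E(ℚ_∞)[p^∞] = 0`** (e.g. `E(ℚ)[p] = 0`, tree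
`fixedPoints_kerSubgroup_geomPrimaryTorsion_eq_bot`; `κ` cyclotomic with topological generator `γ`, ANY dual datum `D`): no
finite-generation, torsion or control hypothesis is left — `X` is finitely generated (`module_finite_of_isCyclotomic`), `ker g_n` is
finite at every layer (g42 `finite_kerG_of_isOrdinaryAt`, Greenberg's Lemmas 3.3–3.4 at layer `n`). ONE inequality
`#Sel_k[p] · #ker g_k · p^{p^j} < #Sel_j[p] · p^{p^k}`, `j < k`, gives `X` torsion, `μ(X) = 0`, `p^{λ(X)} ≤ #Sel_k[p] · #ker g_k`.
[cite: GreenbergLNM1716, §1 Conj. 1.11 and pp. 60–62; §3 Lemmas 3.1–3.4] [cite: Washington1997, §13.3 Prop. 13.23] [cite: Fukuda1994, Thm. 1] -/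
theorem isTorsion_and_mu_eq_zero_of_selmer_rankJump_rat (hord : IsOrdinaryAt W p)
    (hB : FixedPoints.addSubgroup κ.kerSubgroup (W.geomPrimaryTorsion p) = ⊥) (hκ : κ.IsCyclotomic)
    (hγ : κ.IsTopGenerator γ)
    (D : W.SelmerDualData κ γ) {j k : ℕ} (hjk : j < k)
    (hlt : Nat.card ((↥(W.selmerLayer κ k))[(p : ℤ)]) * Nat.card (W.KerG κ k) * p ^ (p ^ j) <
      Nat.card ((↥(W.selmerLayer κ j))[(p : ℤ)]) * p ^ (p ^ k)) :
    D.IsTorsion ∧ D.mu = 0 ∧ Module.Finite ℤ_[p] (RestrictScalars ℤ_[p] (IwasawaAlgebra p) D.X) ∧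
      p ^ D.lambda ≤ Nat.card ((↥(W.selmerLayer κ k))[(p : ℤ)]) * Nat.card (W.KerG κ k) := by
  haveI : Module.Finite (IwasawaAlgebra p) D.X := SelmerDualData.module_finite_of_isCyclotomic W κ hκ D hγ
  haveI : Finite (W.KerG κ k) := finite_kerG_of_isOrdinaryAt W hord hκ k
  exact isTorsion_and_mu_eq_zero_of_selmer_rankJump W κ hγ D hB hjk hlt

omit [W.IsGloballyMinimal] in
/-- `E(ℚ_∞)[2^∞] = 0` for the cyclotomic `ℤ₂`-extension when `W` has no rational point of order `2` (att-p4 / FineRoad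
`TorsionCoefficients.smul_eq_self_kerSubgroup_imp_eq_zero`, packaged as the vanishing of the fixed-point subgroup).
[cite: Ribet1981CyclotomicTorsion, Thm. 1, pp. 315–316] -/
theorem fixedPoints_eq_bot_two (κ : ZpExtension ℚ 2) (hκ : κ.IsCyclotomic) (ht : ∀ x : ℚ, ¬ HasRationalTwoTorsionX W x) :
    FixedPoints.addSubgroup κ.kerSubgroup (W.geomPrimaryTorsion 2) = ⊥ := by
  refine eq_bot_iff.mpr fun m hm ↦ (AddSubgroup.mem_bot).mpr ?_
  exact TorsionCoefficients.smul_eq_self_kerSubgroup_imp_eq_zero W κ hκ ht m ((FixedPoints.mem_addSubgroup (M := κ.kerSubgroup) (α := W.geomPrimaryTorsion 2) m).mp hm)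

/-- ★★★★ **STUB T PER CURVE BY `2`-DESCENT AT TWO LAYERS.** For EVERY `W/ℚ` (globally minimal, elliptic) good ordinary at `2`
WITHOUT a rational point of order `2`, the cyclotomic `ℤ₂`-extension `κ` with topological generator `γ`, and ANY dual datum `D`:
if for ONE pair of layers `j < k` of the tower `ℚ ⊂ ℚ(√2) ⊂ ℚ(ζ₁₆)⁺ ⊂ ⋯`
`#Sel_k[2] · #ker g_k · 2^{2^j} < #Sel_j[2] · 2^{2^k}` (`Sel_n = Sel_{2^∞}(E_{ℚ_n}/ℚ_n)` realised as `W.selmerLayer κ n`, g39;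
`ker g_n` = Greenberg's finite local defect, `#ker g_n ≤ ∏_{v ∣ 2N} #𝒦_{v,n}`), then **`X(W/ℚ_∞)` is `Λ`-torsion and `μ₂(X) = 0`** —
the conclusion `D.IsTorsion → D.mu = 0` of the registered OPEN stub `SeedMuZeroAtTwo` at this `(W, κ, γ, D)`, with the bonus
`2^{λ} ≤ #Sel_k[2] · #ker g_k`. No `¬CM`, `Δ ∉ ℚ²`, `r_an = 0`, `μ_an = 0` or `BSD₂` input is used. The inequality itself is a
COMPUTATION (two `2`-descents), not supplied here; since `#ker g_n ≥ 4` at `2`, it can first hold at `(j, k)` with `2^k − 2^j ≥ 3`.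
[cite: GreenbergLNM1716, §1 Conj. 1.11; §3 Lemmas 3.1–3.4] [cite: Washington1997, §13.3 Prop. 13.23] [cite: Fukuda1994, Thm. 1] -/
theorem seedMuZero_of_selmer_rankJump_two (hord : IsOrdinaryAt W 2) (ht : ∀ x : ℚ, ¬ HasRationalTwoTorsionX W x)
    (κ : ZpExtension ℚ 2) (hκ : κ.IsCyclotomic) {γ : Field.absoluteGaloisGroup ℚ} (hγ : κ.IsTopGenerator γ)
    (D : W.SelmerDualData κ γ) {j k : ℕ} (hjk : j < k)
    (hlt : Nat.card ((↥(W.selmerLayer κ k))[(2 : ℤ)]) * Nat.card (W.KerG κ k) * 2 ^ (2 ^ j) <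
      Nat.card ((↥(W.selmerLayer κ j))[(2 : ℤ)]) * 2 ^ (2 ^ k)) :
    D.IsTorsion ∧ D.mu = 0 ∧ Module.Finite ℤ_[2] (RestrictScalars ℤ_[2] (IwasawaAlgebra 2) D.X) ∧
      2 ^ D.lambda ≤ Nat.card ((↥(W.selmerLayer κ k))[(2 : ℤ)]) * Nat.card (W.KerG κ k) := by
  haveI : Module.Finite (IwasawaAlgebra 2) D.X := SelmerDualData.module_finite_of_isCyclotomic W κ hκ D hγ
  haveI : Finite (W.KerG κ k) := finite_kerG_of_isOrdinaryAt W hord hκ k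
  exact isTorsion_and_mu_eq_zero_of_selmer_rankJump W κ hγ D (fixedPoints_eq_bot_two W κ hκ ht) hjk
    (by exact_mod_cast hlt)

end Rat

end Summit.BirchSwinnertonDyer.BirchSwinnertonDyer.Theorems.AlignedTransportAtTwoSelmerLayerMuDoor

end
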